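import Mathlib
import Summits.Ventures.HodgeRepro.Tier4.Common.AdelicDefs
import Summits.Ventures.HodgeRepro.Tier4.Common.CompactOpenLevel
import Summits.Ventures.HodgeRepro.Tier4.Line1.PlaneDefs
import Summits.Ventures.HodgeRepro.Tier4.Line1.RationalConjScalar
import Summits.Ventures.HodgeRepro.Tier4.Line1.C7BoxCompact

/-!
# Tier4/Line1/AdelicParts — the archimedean and finite parts of adelic matrices and vectors, the rational retraction
`𝔸_{k,f} → k`, and rational points of `U(W)` from rational unitary matrices (the vocabulary of finite-adelic J2.b)

Blind re-derivation cell `pub-hodge-repro`, Tier 4 (README §9–§10), seat t4-L1-p4 (gen 4); support for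
`Tier4/Line1/RationalConjFinite.lean` (t4-plan-1 g2's adjudication S13794, names S13818).  Target tree path
`lean/Summits/Ventures/HodgeRepro/Tier4/Line1/AdelicParts.lean`.  Mathlib + typer-2's `AdelicDefs` / `CompactOpenLevel`
(`infPart`, `finPart`), p2's `RationalConjScalar` (`mem_rationalPoints_of_mat`) and this seat's `C7BoxCompact`
(`det_ne_zero_of_isDefinite`); no printed input.

WHAT IS HERE.  `𝔸_k = 𝔸_{k,∞} × 𝔸_{k,f}` entrywise: `infM` / `finM` (the two parts of a `4 × 4` adelic matrix, ring
homomorphisms entrywise), `mixM` (an adelic matrix from its two parts), `mkAd`, `infV` / `finV` (vectors), the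
extensionality lemmas `M4_ext` / `V4_ext` / `Ad_ext` and the compatibilities with `*`, `1`, `0`, `ᵀ`, `ᵥ*`, `•`, `adMat`.
`algebraMap_finiteAdele_injective` (evaluate at one finite place — `𝓞_k` is not a field, so a maximal ideal is a
height-one prime) and **`exists_retraction_finiteAdele`**: a `k`-linear `φ : 𝔸_{k,f} → k` with `φ ∘ algebraMap = id`
(`LinearMap.exists_leftInverse_of_injective`), with the three `Matrix.map φ` lemmas that make `φ` preserve every
matrix equation with RATIONAL coefficients (`map_mul_algMat`, `algMat_mul_map`, `map_algMat_map`).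
**`GA.ofRationalMat`**: the element of `U(W)(𝔸_k)` with a given rational matrix `D` satisfying `D Ω = Ω D`,
`D B Dᵀ = B`, `det D ≠ 0`; it is a rational point (`GA.ofRationalMat_mem_rationalPoints`); `det_ne_zero_of_form`:
`D B Dᵀ = B` forces `det D ≠ 0` on a definite plane.
Nothing here says anything about the status of the Hodge conjecture for CM abelian varieties, which is NOT proved
(HC_CM is NOT proved by anyone in this repository).
-/

set_option autoImplicit false

noncomputable section

namespace Summit.Ventures.HodgeRepro.Tier4.Line1

open Matrix NumberField IsDedekindDomain Summit.Ventures.HodgeRepro.Tier4.Common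
open scoped NumberField

/-! ### The two parts of an adelic matrix -/

section Parts

variable (k : Type) [Field k] [NumberField k]

/-- the finite part of an adelic matrix, entrywise -/
def finM (M : M4 k) : Matrix (Fin 4) (Fin 4) (FiniteAdeleRing (𝓞 k) k) := M.map (finPart k)

/-- the archimedean part of an adelic matrix, entrywise -/
def infM (M : M4 k) : Matrix (Fin 4) (Fin 4) (InfiniteAdeleRing k) := M.map (infPart k)

/-- an adelic matrix from its two parts -/
def mixM (A : Matrix (Fin 4) (Fin 4) (InfiniteAdeleRing k)) (B : Matrix (Fin 4) (Fin 4) (FiniteAdeleRing (𝓞 k) k)) :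
    M4 k := Matrix.of fun i j => (A i j, B i j)

/-- an adele from its two parts -/
def mkAd (a : InfiniteAdeleRing k) (b : FiniteAdeleRing (𝓞 k) k) : Ad k := (a, b)

/-- the finite part of an adelic vector -/
def finV (v : Fin 4 → Ad k) : Fin 4 → FiniteAdeleRing (𝓞 k) k := finPart k ∘ v

/-- the archimedean part of an adelic vector -/
def infV (v : Fin 4 → Ad k) : Fin 4 → InfiniteAdeleRing k := infPart k ∘ v

variable {k}

/-- the archimedean part of `mkAd a b` is `a` -/
theorem infPart_mkAd (a : InfiniteAdeleRing k) (b : FiniteAdeleRing (𝓞 k) k) : infPart k (mkAd k a b) = a := rfl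
/-- the finite part of `mkAd a b` is `b` -/
theorem finPart_mkAd (a : InfiniteAdeleRing k) (b : FiniteAdeleRing (𝓞 k) k) : finPart k (mkAd k a b) = b := rfl

/-- an adele is determined by its two parts -/
theorem Ad_ext {a b : Ad k} (h1 : infPart k a = infPart k b) (h2 : finPart k a = finPart k b) : a = b :=
  Prod.ext h1 h2

/-- the archimedean part of `mixM A B` is `A` -/
theorem infM_mixM (A : Matrix (Fin 4) (Fin 4) (InfiniteAdeleRing k))
    (B : Matrix (Fin 4) (Fin 4) (FiniteAdeleRing (𝓞 k) k)) : infM k (mixM k A B) = A := by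
  ext i j
  rfl

/-- the finite part of `mixM A B` is `B` -/
theorem finM_mixM (A : Matrix (Fin 4) (Fin 4) (InfiniteAdeleRing k))
    (B : Matrix (Fin 4) (Fin 4) (FiniteAdeleRing (𝓞 k) k)) : finM k (mixM k A B) = B := by
  ext i j
  rfl

/-- an adelic matrix is determined by its two parts -/
theorem M4_ext {M N : M4 k} (h1 : infM k M = infM k N) (h2 : finM k M = finM k N) : M = N := by
  ext i j
  exact Prod.ext (congrFun (congrFun h1 i) j) (congrFun (congrFun h2 i) j)

/-- an adelic vector is determined by its two parts -/
theorem V4_ext {v w : Fin 4 → Ad k} (h1 : infV k v = infV k w) (h2 : finV k v = finV k w) : v = w := by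
  funext i
  exact Prod.ext (congrFun h1 i) (congrFun h2 i)

/-- the finite part of a product -/
theorem finM_mul (M N : M4 k) : finM k (M * N) = finM k M * finM k N := Matrix.map_mul (f := finPart k)
/-- the archimedean part of a product -/
theorem infM_mul (M N : M4 k) : infM k (M * N) = infM k M * infM k N := Matrix.map_mul (f := infPart k)
/-- the finite part of `1` -/
theorem finM_one : finM k (1 : M4 k) = 1 := Matrix.map_one (finPart k) (map_zero _) (map_one _)
/-- the archimedean part of `1` -/
theorem infM_one : infM k (1 : M4 k) = 1 := Matrix.map_one (infPart k) (map_zero _) (map_one _)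
/-- the finite part of `0` -/
theorem finM_zero : finM k (0 : M4 k) = 0 := Matrix.map_zero (finPart k) (map_zero _)
/-- the archimedean part of `0` -/
theorem infM_zero : infM k (0 : M4 k) = 0 := Matrix.map_zero (infPart k) (map_zero _)
/-- the finite part of a difference -/
theorem finM_sub (M N : M4 k) : finM k (M - N) = finM k M - finM k N :=
  Matrix.map_sub (finPart k) (fun a b => map_sub (finPart k) a b) M N
/-- the finite part of a transpose -/
theorem finM_transpose (M : M4 k) : finM k Mᵀ = (finM k M)ᵀ := Matrix.transpose_map (f := finPart k) (M := M)

/-- the finite part of a rational matrix -/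
theorem finM_adMat (A : Matrix (Fin 4) (Fin 4) k) :
    finM k (adMat k A) = A.map (algebraMap k (FiniteAdeleRing (𝓞 k) k)) := by
  ext i j
  rfl

/-- the archimedean part of a rational matrix -/
theorem infM_adMat (A : Matrix (Fin 4) (Fin 4) k) :
    infM k (adMat k A) = A.map (algebraMap k (InfiniteAdeleRing k)) := by
  ext i j
  rfl

/-- the finite part of a row-vector product -/
theorem finV_vecMul (v : Fin 4 → Ad k) (M : M4 k) : finV k (v ᵥ* M) = finV k v ᵥ* finM k M := by
  funext i
  exact RingHom.map_vecMul (finPart k) M v i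

/-- the archimedean part of a row-vector product -/
theorem infV_vecMul (v : Fin 4 → Ad k) (M : M4 k) : infV k (v ᵥ* M) = infV k v ᵥ* infM k M := by
  funext i
  exact RingHom.map_vecMul (infPart k) M v i

/-- the finite part of a vector sum -/
theorem finV_add (v w : Fin 4 → Ad k) : finV k (v + w) = finV k v + finV k w := by
  funext i
  exact map_add _ _ _

/-- the archimedean part of a vector sum -/
theorem infV_add (v w : Fin 4 → Ad k) : infV k (v + w) = infV k v + infV k w := by
  funext i
  exact map_add _ _ _

/-- the finite part of a scalar multiple -/
theorem finV_smul (x : Ad k) (v : Fin 4 → Ad k) : finV k (x • v) = finPart k x • finV k v := by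
  funext i
  exact map_mul _ _ _

/-- the archimedean part of a scalar multiple -/
theorem infV_smul (x : Ad k) (v : Fin 4 → Ad k) : infV k (x • v) = infPart k x • infV k v := by
  funext i
  exact map_mul _ _ _

/-- the finite part of a rational vector -/
theorem finV_algebraMap_comp (w : Fin 4 → k) :
    finV k (algebraMap k (Ad k) ∘ w) = algebraMap k (FiniteAdeleRing (𝓞 k) k) ∘ w := rfl

/-- the archimedean part of a rational vector -/
theorem infV_algebraMap_comp (w : Fin 4 → k) :
    infV k (algebraMap k (Ad k) ∘ w) = algebraMap k (InfiniteAdeleRing k) ∘ w := rfl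

/-- the finite part of a rational adele -/
theorem finPart_algebraMap (c : k) :
    finPart k (algebraMap k (Ad k) c) = algebraMap k (FiniteAdeleRing (𝓞 k) k) c := rfl

/-- the archimedean part of a rational adele -/
theorem infPart_algebraMap (c : k) :
    infPart k (algebraMap k (Ad k) c) = algebraMap k (InfiniteAdeleRing k) c := rfl

end Parts

/-! ### `k ↪ 𝔸_f`, and the rational retraction -/

section Retraction

variable {k : Type} [Field k] [NumberField k]

/-- the structure map `k → 𝔸_{k,f}` is injective (evaluate at one finite place) -/
theorem algebraMap_finiteAdele_injective :
    Function.Injective (algebraMap k (FiniteAdeleRing (𝓞 k) k)) := by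
  obtain ⟨P, hP⟩ := Ideal.exists_maximal (𝓞 k)
  have hne : P ≠ ⊥ := Ring.ne_bot_of_isMaximal_of_not_isField hP (NumberField.RingOfIntegers.not_isField k)
  let v : IsDedekindDomain.HeightOneSpectrum (𝓞 k) := ⟨P, hP.isPrime, hne⟩
  intro a b hab
  have h := congrArg (fun x : FiniteAdeleRing (𝓞 k) k => x v) hab
  simp only [FiniteAdeleRing.algebraMap_apply] at h
  exact (algebraMap k (v.adicCompletion k)).injective h

/-- a `k`-linear retraction of `𝔸_{k,f}` onto `k` -/
theorem exists_retraction_finiteAdele :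
    ∃ φ : FiniteAdeleRing (𝓞 k) k →ₗ[k] k, ∀ c : k, φ (algebraMap k (FiniteAdeleRing (𝓞 k) k) c) = c := by
  have hker : LinearMap.ker (Algebra.linearMap k (FiniteAdeleRing (𝓞 k) k)) = ⊥ := by
    rw [LinearMap.ker_eq_bot]
    exact algebraMap_finiteAdele_injective
  obtain ⟨φ, hφ⟩ := (Algebra.linearMap k (FiniteAdeleRing (𝓞 k) k)).exists_leftInverse_of_injective hker
  refine ⟨φ, fun c => ?_⟩
  have := LinearMap.congr_fun hφ c
  simpa using this

variable (φ : FiniteAdeleRing (𝓞 k) k →ₗ[k] k)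

/-- the retraction undoes the extension of scalars on matrices -/
theorem map_algMat_map (hφ : ∀ c : k, φ (algebraMap k (FiniteAdeleRing (𝓞 k) k) c) = c)
    (A : Matrix (Fin 4) (Fin 4) k) :
    (A.map (algebraMap k (FiniteAdeleRing (𝓞 k) k))).map φ = A := by
  ext i j
  simp only [Matrix.map_apply, hφ]

/-- the retraction commutes with right multiplication by a rational matrix -/
theorem map_mul_algMat (Y : Matrix (Fin 4) (Fin 4) (FiniteAdeleRing (𝓞 k) k)) (A : Matrix (Fin 4) (Fin 4) k) :
    (Y * A.map (algebraMap k (FiniteAdeleRing (𝓞 k) k))).map φ = Y.map φ * A := by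
  ext i j
  simp only [Matrix.map_apply, Matrix.mul_apply, map_sum]
  refine Finset.sum_congr rfl fun l _ => ?_
  rw [mul_comm (Y i l), ← Algebra.smul_def, map_smul, smul_eq_mul, mul_comm]

/-- the retraction commutes with left multiplication by a rational matrix -/
theorem algMat_mul_map (A : Matrix (Fin 4) (Fin 4) k) (Y : Matrix (Fin 4) (Fin 4) (FiniteAdeleRing (𝓞 k) k)) :
    (A.map (algebraMap k (FiniteAdeleRing (𝓞 k) k)) * Y).map φ = A * Y.map φ := by
  ext i j
  simp only [Matrix.map_apply, Matrix.mul_apply, map_sum]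
  refine Finset.sum_congr rfl fun l _ => ?_
  rw [← Algebra.smul_def, map_smul, smul_eq_mul]

end Retraction

/-! ### Rational points from rational unitary matrices -/

section OfRational

variable {k : Type} [Field k] [NumberField k] (W : PlaneData k)

/-- **the element of `G(𝔸_k)` with a given rational unitary matrix** -/
def GA.ofRationalMat (D : Matrix (Fin 4) (Fin 4) k) (hdet : D.det ≠ 0) (hΩ : D * W.Ω = W.Ω * D)
    (hB : D * W.B * Dᵀ = W.B) : GA W :=
  ⟨Matrix.GeneralLinearGroup.map (algebraMap k (Ad k)) (Matrix.GeneralLinearGroup.mkOfDetNeZero D hdet), by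
    refine ⟨?_, ?_⟩
    · change adMat k D * adMat k W.Ω = adMat k W.Ω * adMat k D
      rw [← adMat_mul, ← adMat_mul, hΩ]
    · change adMat k D * adMat k W.B * (adMat k D)ᵀ = adMat k W.B
      rw [← adMat_transpose, ← adMat_mul, ← adMat_mul, hB]⟩

/-- the matrix of `GA.ofRationalMat D` is `adMat D` -/
theorem GA.mat_ofRationalMat (D : Matrix (Fin 4) (Fin 4) k) (hdet : D.det ≠ 0) (hΩ : D * W.Ω = W.Ω * D)
    (hB : D * W.B * Dᵀ = W.B) : GA.mat W (GA.ofRationalMat W D hdet hΩ hB) = adMat k D := rfl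

/-- `GA.ofRationalMat D` is a rational point -/
theorem GA.ofRationalMat_mem_rationalPoints (D : Matrix (Fin 4) (Fin 4) k) (hdet : D.det ≠ 0)
    (hΩ : D * W.Ω = W.Ω * D) (hB : D * W.B * Dᵀ = W.B) :
    GA.ofRationalMat W D hdet hΩ hB ∈ rationalPoints W :=
  mem_rationalPoints_of_mat W _ (GA.mat_ofRationalMat W D hdet hΩ hB)

omit [NumberField k] in
/-- a rational matrix preserving a definite form has non-zero determinant -/
theorem det_ne_zero_of_form (hW : IsDefinite W) {D : Matrix (Fin 4) (Fin 4) k} (hB : D * W.B * Dᵀ = W.B) :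
    D.det ≠ 0 := by
  intro h0
  have hdetB := det_ne_zero_of_isDefinite W hW
  apply hdetB
  rw [← hB, Matrix.det_mul, Matrix.det_mul, h0, zero_mul, zero_mul]

end OfRational

end Summit.Ventures.HodgeRepro.Tier4.Line1

end
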